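import Literature.NumberTheory.EllipticCurves.SelmerProofs
import HarnessLib

/-!
# The COUPLED Cassels–Tate telescope, XXVI: the bottom class `x = δ x₀` has EXACT order `2^{2κ}` when
# `x₀ ∉ 2E(K) + tors` (the per-level (T-L5) clause `2^(2κ−1) • x ≠ 0` of RESIDUE c v3)

Crux `UpperOffV0HSYPlus` (stmt-BirchSwinnertonDyer-19804), rows' display RESIDUE c v3 (`…TailFourOfResidue` p714972,
l.76–79): `x = kummerMapTorsion E_K (2^κ·2^κ) _ x₀ ∧ 2^(2κ−1) • x ≠ 0 ∧ …`.  With the provenance leaf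
(`…CoupledTelescopeProvenance.provenance_sylvesterPair`: `x₀ ∉ 2E_p(K) + E_p(K)_tors`) the middle clause is the
exactness of the Kummer sequence at `E(K)/n` (tree `kummerMapTorsion_ker`: `δ_n P = 0 ↔ P ∈ n E(K)`): if
`2^(2κ−1) • δ x₀ = δ(2^(2κ−1) • x₀) = 0` then `2^(2κ−1) • x₀ = 2^(2κ) • Q`, so `x₀ − 2 • Q` is killed by
`2^(2κ−1)`, i.e. torsion — `x₀ ∈ 2E(K) + tors`.  Generic (any Weierstrass curve over a perfect field of
characteristic `0`, any `κ ≥ 1`, any divisibility witness `hdiv` — proof-irrelevant, so the display's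
`zsmul_geomPoints_surjective_of_charZero …` term matches).
* ★ `two_pow_pred_zsmul_kummerMapTorsion_ne_zero`.
Theorem-only (no definition, no named fact); nothing asserted on 19804; no stub closed; X12.CMAtTwo NOT proved; BSD not
claimed for any curve.  Sources: Silverman AEC VIII.§2 (Kummer sequence); McCallum 1991 §5 (proof of Thm. 5.4, `ord c_M(1)`).
-/

-- every Summits module is named `Summit.<Summit>.<Problem>…`: the duplicated component is by design
set_option linter.dupNamespace false
set_option autoImplicit false

noncomputable section

open scoped Classical
open WeierstrassCurve Literature.NumberTheory.EllipticCurves Literature.NumberTheory.GaloisRepresentations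

namespace Summit.BirchSwinnertonDyer.BirchSwinnertonDyer.Theorems.SylvesterTwoCoupledTelescope

universe u

variable {F : Type u} [Field F] [PerfectField F] (W : WeierstrassCurve F)

/-- ★ **`2^(2κ−1) • δ_{4^κ} x₀ ≠ 0` when `x₀ ∉ 2E(F) + E(F)_tors`** (RESIDUE c v3 l.79, middle clause; module
docstring).  [cite: SilvermanAEC2009, §VIII.2 (Kummer sequence)] [cite: McCallumLMS1991, §5 Thm. 5.4 (proof)] -/
theorem two_pow_pred_zsmul_kummerMapTorsion_ne_zero (κ : ℕ) (hκ : 1 ≤ κ)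
    (hdiv : Function.Surjective fun Q : geomPoints W ↦ (((2 ^ κ * 2 ^ κ : ℕ) : ℤ)) • Q)
    (x₀ : W.toAffine.Point) (hx₀ : ¬ ∃ (Q T : W.toAffine.Point), IsOfFinAddOrder T ∧ x₀ = 2 • Q + T) :
    ((2 : ℤ) ^ (2 * κ - 1)) • kummerMapTorsion W (((2 ^ κ * 2 ^ κ : ℕ) : ℤ)) hdiv x₀ ≠ 0 := by
  intro h
  -- `2^(2κ−1) • x₀ ∈ ker δ = 4^κ E(F)`
  have hker : ((2 : ℤ) ^ (2 * κ - 1)) • x₀ ∈ (kummerMapTorsion W (((2 ^ κ * 2 ^ κ : ℕ) : ℤ)) hdiv).ker := by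
    rw [AddMonoidHom.mem_ker, map_zsmul, h]
  rw [kummerMapTorsion_ker] at hker
  obtain ⟨Q, hQ⟩ := hker
  change (((2 ^ κ * 2 ^ κ : ℕ) : ℤ)) • Q = ((2 : ℤ) ^ (2 * κ - 1)) • x₀ at hQ
  have hlev : (((2 ^ κ * 2 ^ κ : ℕ) : ℤ)) = (2 : ℤ) ^ (2 * κ - 1) * 2 := by
    push_cast
    rw [← pow_add, ← pow_succ]
    congr 1
    omega
  -- `x₀ − 2 • Q` is killed by `2^(2κ−1)`, hence torsion
  have htor : IsOfFinAddOrder (x₀ - 2 • Q) := by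
    rw [isOfFinAddOrder_iff_zsmul_eq_zero]
    refine ⟨(2 : ℤ) ^ (2 * κ - 1), pow_ne_zero _ two_ne_zero, ?_⟩
    rw [zsmul_sub, ← hQ, hlev, mul_smul, two_zsmul, two_nsmul, sub_self]
  exact hx₀ ⟨Q, x₀ - 2 • Q, htor, by abel⟩

end Summit.BirchSwinnertonDyer.BirchSwinnertonDyer.Theorems.SylvesterTwoCoupledTelescope

end
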